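/-
COR-CM (cell pub-hodgecm2, stage 2 of the Hodge ladder) — count-neutral KERNEL CENSUS TRANSPORT, degree 8, non-abelian types (seat
prover-pub-hodgecm2-b23-g32-0, binder prover b23, gen 32; claim INT2-TRANSPORT, HOME/lit/LIT-STATUS.md 2026-08-21T15:20:31Z;
sequel of `CorCM/FaceCensusTransport.lean`). Theorems only: two closed `Bool` side checks per Galois type decided in the kernel
(`decide +kernel`) against seat b30's census data (`Census/OcticFaceSquaresQuaternion.lean`,
`Census/OcticFaceSquaresDihedral.lean`: `Γ`, `genReps`, `certs`, `generation` — used BY NAME, nothing restated or re-filed) and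
the resulting field-closure theorems. No definition, no named fact, nothing asserted; `Interfaces.lean` (C1), every E term, B01
and `Transposition/*` are untouched. HONEST FRAMING (COORDINATOR RULING — HODGE FRAMING CORRECTION, 2026-08-21T11:55:35Z): `HC_CM`
is NOT proved, here or anywhere in the tree. Every closing theorem below is CONDITIONAL on face-period witnesses (for ONE field,
on the listed faces); no period is proved here.
T5 (coordinator ruling 15:33:56Z (3), lead staging l.4095): the census binders of the transport are DISCHARGED here by `decide`
(`orbitCells`, `pairLabels`, b30's `generation`); the dictionary binders (`e`, `hmul`, `hconj` / `ε`, `hε`, `c`) say «Gal(K/ℚ) ≅ this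
type with complex conjugation ↦ `Γ.conj`» and are inhabited by every Galois CM field of this type (examples in the docstring of
b30's census file); the face-reading binders are INHABITED IN THE KERNEL for every such enumeration (`exists_faces_octic*` below,
from `FaceCensus.exists_face_reads`); the only remaining hypotheses are the period witnesses / Weil-line algebraicity on the listed
faces = instances of the crux (`FacePeriodExists` / B01-S), against which the tree has no `¬` theorem on the universe of record —
no contradiction derivable; checker: self (prover-pub-hodgecm2-b23-g32-0), 2026-08-21T16:20Z.
-/
import Summits.HodgeConjecture.CorCM.FaceCensusTransport
import Summits.HodgeConjecture.CorCM.Census.OcticFaceSquaresQuaternion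
import Summits.HodgeConjecture.CorCM.Census.OcticFaceSquaresDihedral
import HarnessLib

/-!
# Degree 8, types `Q₈` and `D₄`: TWO face periods per field close its slice (census transport, instances)

Census transport instances (`FaceCensus.hgen_of_generationCertOK`, `CorCM/FaceCensusTransport.lean`) for the two non-abelian
Galois CM closure types of order `8` certified by seat b30: `Q₈` (`Census/OcticFaceSquaresQuaternion.lean`, `c = a 2`; TWO
generating orbits of three, codes `(51, 5, 10)`, `(51, 5, 80)`) and `D₄` (`Census/OcticFaceSquaresDihedral.lean`, `c = r 2`; TWO
of five, same codes). For each type: the two side checks of the transport on b30's data by `decide +kernel` (`orbitCells`,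
`pairLabels`); the generation binder `hgen(𝒮, σ₀)` of INT2-GEN for every set `𝒮` of faces of a Galois CM field `K` of that type
containing faces that READ AS b30's generating representatives under an enumeration `e : GalT K ≃ Fin 8` of the table (`e (P * Q)
= Γ.mul (e P) (e Q)`, `e conjT = Γ.conj`; a representative code `(T, p, q)` is read as «`σ₀ ∘ P ∈ R.Φ ↔` bit `e P` of `T`»,
«`R.p`, `R.p′` at the places with masks `p`, `q`»); and the CLOSED field-closure theorems on the universe of record — period
witnesses (or algebraic Weil lines) on those `2` faces ⟹ the Hodge conjecture, in every codimension, for every complex abelian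
variety dominated by a finite product of abelian varieties realising CM types of CM fields embeddable in `K` — in the `GalT` form
and in the AUTOMORPHISM form a field-specific seat has (`ε : Aut(K) ≃ Fin 8`, complex conjugation `c` at `σ₀`; bridge
`FaceCensus.exists_enum_of_autEnum`, `CorCM/FaceCensusCells.lean`). This is the FIELD-CLOSURE step of the degree-by-degree
fallback ladder (RE-POINT 12:07:17Z (3)) as a kernel theorem per Galois type; `HC_CM` is NOT proved and nothing here produces a
period.

References: [cite: Pohlmann1968, Thm. 1]; [cite: Milne1999LefschetzClasses, Thm. 3.2 and Cor. 4.5];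
[cite: Shimura1998, §6.2 Theorem 3 and §6.1 Corollary of Theorem 2 (pp. 41–43)]; [cite: MumfordAV1970, §19 Thm. 1 and p. 169].
-/

noncomputable section

open CategoryTheory NumberField NumberField.ComplexEmbedding
open Literature.AlgebraicGeometry Literature.AlgebraicGeometry.Motives Literature.AlgebraicGeometry.HodgeTheory
open Literature.AlgebraicGeometry.ComplexMultiplication Literature.AlgebraicGeometry.Milne1999
open Literature.NumberTheory.Automorphic
open Literature.NumberTheory.Automorphic.PicardCM
open Summit.HodgeConjecture.CorCM.Domination

namespace Summit.HodgeConjecture.CorCM.OcticFaceTransport.Quaternion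

open Summit.HodgeConjecture.CorCM.Census.FaceSquaresModel (mem flipAt)
open Summit.HodgeConjecture.CorCM.Census.OcticFaceSquaresQuaternion (Γ genReps certs generation)

/-- **Side check 1 (orbit cells), type `Q₈` (`QuaternionGroup 2`, `c = a 2`, index `2`):** every generator face of b30's certificates
is one of the eight faces of an explicit orbit cell of a generating representative (four square mates over the twisted places,
both orders). [folklore] -/
theorem orbitCells : (certs.all fun c => c.2.1.all fun gi => genReps.any fun r => (List.finRange 8).any fun j =>
    [(Γ.twist j r.1, Γ.twist j r.2.1, Γ.twist j r.2.2),
      (flipAt (Γ.twist j r.2.1) (Γ.twist j r.1), Γ.twist j r.2.1, Γ.twist j r.2.2),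
      (flipAt (Γ.twist j r.2.2) (Γ.twist j r.1), Γ.twist j r.2.1, Γ.twist j r.2.2),
      (flipAt (Γ.twist j r.2.2) (flipAt (Γ.twist j r.2.1) (Γ.twist j r.1)), Γ.twist j r.2.1, Γ.twist j r.2.2),
      (Γ.twist j r.1, Γ.twist j r.2.2, Γ.twist j r.2.1),
      (flipAt (Γ.twist j r.2.1) (Γ.twist j r.1), Γ.twist j r.2.2, Γ.twist j r.2.1),
      (flipAt (Γ.twist j r.2.2) (Γ.twist j r.1), Γ.twist j r.2.2, Γ.twist j r.2.1),
      (flipAt (Γ.twist j r.2.2) (flipAt (Γ.twist j r.2.1) (Γ.twist j r.1)), Γ.twist j r.2.2, Γ.twist j r.2.1)].contains gi.1)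
    = true := by
  decide +kernel

/-- **Side check 2 (pair labels), type `Q₈` (`QuaternionGroup 2`, `c = a 2`, index `2`):** every divisor-pair label of b30's
certificates is a CM type of the model. [folklore] -/
theorem pairLabels : (certs.all fun c => c.2.2.all fun pj => Γ.isCMType pj.1) = true := by
  decide +kernel

/-- **The generation binder, type `Q₈` (`QuaternionGroup 2`, `c = a 2`, index `2`).** `K` a Galois CM field with an enumeration `e :
GalT K ≃ Fin 8` of its Galois translates, multiplicative for b30's table and with `e conjT = 2`; `σ₀` a base embedding; `𝒮` any
set of faces of `K` containing faces READING AS the 2 generating representative codes `(51, 5, 10)` (type `{0,1,4,5}`, places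
`{0,2}`, `{1,3}`), `(51, 5, 80)` (type `{0,1,4,5}`, places `{0,2}`, `{4,6}`) — `σ₀ ∘ P ∈ R.Φ ↔ e P ∈` the type, `R.p`, `R.p′` at
the two places. Then `hgen(𝒮, σ₀)` holds at every face (b30's `generation`: two orbits of the three generate). [cite:
Pohlmann1968, Thm. 1] [cite: Milne1999LefschetzClasses, Thm. 3.2] -/
theorem hgen_octicQuaternion (K : CMField) [IsGalois ℚ K] (e : GalT K ≃ Fin 8)
    (hmul : ∀ P Q : GalT K, e (P * Q) = Γ.mul (e P) (e Q)) (hconj : e conjT = Γ.conj) (σ₀ : (K : Type) →+* ℂ)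
    (𝒮 : Set (Face K))
    (h₁ : ∃ R ∈ 𝒮, (∀ P : GalT K, P.1 σ₀ ∈ R.Φ.1 ↔ mem (e P) 51 = true) ∧
      Γ.placeMask (e (translate σ₀ R.p)) = 5 ∧ Γ.placeMask (e (translate σ₀ R.p')) = 10)
    (h₂ : ∃ R ∈ 𝒮, (∀ P : GalT K, P.1 σ₀ ∈ R.Φ.1 ↔ mem (e P) 51 = true) ∧
      Γ.placeMask (e (translate σ₀ R.p)) = 5 ∧ Γ.placeMask (e (translate σ₀ R.p')) = 80) (f : Face K) :
    lefChar f.corner (fun _ => ({σ₀} : Finset ((K : Type) →+* ℂ))) ∈ AddSubgroup.closure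
      {a : Asym K | ∃ g ∈ 𝒮, ∃ σ : (K : Type) →+* ℂ, a = lefChar g.corner (fun _ => ({σ} : Finset ((K : Type) →+* ℂ)))} := by
  refine FaceCensus.hgen_of_generationCertOK Γ e hmul hconj genReps certs generation orbitCells pairLabels σ₀ 𝒮 ?_ f
  intro r hr
  have hr' : r = (51, 5, 10) ∨ r = (51, 5, 80) := by simpa [genReps] using hr
  rcases hr' with rfl | rfl
  · obtain ⟨R, hRS, hΦ, hp, hq⟩ := h₁
    exact ⟨R, hRS, ⟨by decide, fun i => by rw [mem_pullType, hΦ, e.apply_symm_apply]⟩, hp, hq⟩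
  · obtain ⟨R, hRS, hΦ, hp, hq⟩ := h₂
    exact ⟨R, hRS, ⟨by decide, fun i => by rw [mem_pullType, hΦ, e.apply_symm_apply]⟩, hp, hq⟩

/-- **Non-vacuity, type `Q₈` (`QuaternionGroup 2`, `c = a 2`, index `2`):** under any such enumeration, faces of `K` reading as the
generating representative codes EXIST (`FaceCensus.exists_face_reads`; the codes lie in `Γ.faces` by `decide`). [folklore] -/
theorem exists_faces_octicQuaternion (K : CMField) [IsGalois ℚ K] (e : GalT K ≃ Fin 8)
    (hmul : ∀ P Q : GalT K, e (P * Q) = Γ.mul (e P) (e Q)) (hconj : e conjT = Γ.conj) (σ₀ : (K : Type) →+* ℂ) :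
    ∃ R₁ R₂ : Face K,
      ((∀ P : GalT K, P.1 σ₀ ∈ R₁.Φ.1 ↔ mem (e P) 51 = true) ∧
      Γ.placeMask (e (translate σ₀ R₁.p)) = 5 ∧ Γ.placeMask (e (translate σ₀ R₁.p')) = 10) ∧
      ((∀ P : GalT K, P.1 σ₀ ∈ R₂.Φ.1 ↔ mem (e P) 51 = true) ∧
      Γ.placeMask (e (translate σ₀ R₂.p)) = 5 ∧ Γ.placeMask (e (translate σ₀ R₂.p')) = 80) := by
  obtain ⟨R₁, hT₁, hp₁, hq₁⟩ := FaceCensus.exists_face_reads Γ e hmul hconj σ₀ (r := (51, 5, 10))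
    (by decide +kernel)
  obtain ⟨R₂, hT₂, hp₂, hq₂⟩ := FaceCensus.exists_face_reads Γ e hmul hconj σ₀ (r := (51, 5, 80))
    (by decide +kernel)
  exact ⟨R₁, R₂, ⟨fun P => by rw [← mem_pullType, ← e.symm_apply_apply P, ← hT₁.2 (e P), e.symm_apply_apply],
    hp₁, hq₁⟩, ⟨fun P => by rw [← mem_pullType, ← e.symm_apply_apply P, ← hT₂.2 (e P), e.symm_apply_apply],
    hp₂, hq₂⟩⟩

/-- **FIELD CLOSURE, type `Q₈` (`QuaternionGroup 2`, `c = a 2`, index `2`) — period-witness form, CLOSED (headline).** `K`, `e`, `σ₀`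
as above and 2 faces of `K` reading as the generating representatives; ONE period witness for each on the universe of record (some
admissible `ι₁`, some hermitian 3-space, some level, eigenforms at some `σ`) implies the Hodge conjecture, in every codimension,
for every complex abelian variety dominated by a finite product of abelian varieties realising CM types of CM fields embeddable in
`K`. (FRAMING: conditional on these 2 face periods; `HC_CM` is not proved.) [cite: Shimura1998, §6.2 Theorem 3 and §6.1 Corollary
of Theorem 2 (pp. 41–43)] [cite: Pohlmann1968, Thm. 1] [cite: Milne1999LefschetzClasses, Thm. 3.2 and Cor. 4.5] [cite:
MumfordAV1970, §19 Thm. 1 and p. 169] -/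
theorem hodgeConjectureFor_of_avDominatedBy_isProductOf_of_facePeriod_octicQuaternion (K : CMField) [IsGalois ℚ K]
    (e : GalT K ≃ Fin 8) (hmul : ∀ P Q : GalT K, e (P * Q) = Γ.mul (e P) (e Q)) (hconj : e conjT = Γ.conj)
    (σ₀ : (K : Type) →+* ℂ) (R₁ R₂ : Face K)
    (hR₁ : (∀ P : GalT K, P.1 σ₀ ∈ R₁.Φ.1 ↔ mem (e P) 51 = true) ∧
      Γ.placeMask (e (translate σ₀ R₁.p)) = 5 ∧ Γ.placeMask (e (translate σ₀ R₁.p')) = 10)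
    (hR₂ : (∀ P : GalT K, P.1 σ₀ ∈ R₂.Φ.1 ↔ mem (e P) 51 = true) ∧
      Γ.placeMask (e (translate σ₀ R₂.p)) = 5 ∧ Γ.placeMask (e (translate σ₀ R₂.p')) = 80)
    (h₁ : ∃ ι₁ : K →+* ℂ, R₁.Admissible ι₁ ∧ ∃ (V : HermSpace3 K ι₁) (σ : K →+* ℂ),
      (Model.picardCMUniverse exists_isReal_hodgeModel_holds hodgePQ_independent_of_hodgeModel_holds
        BallQuotient.ballQuotientUniformised_holds cmAbelianVarietyRealised_holds).PeriodNV ι₁ V K R₁.psi σ)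
    (h₂ : ∃ ι₁ : K →+* ℂ, R₂.Admissible ι₁ ∧ ∃ (V : HermSpace3 K ι₁) (σ : K →+* ℂ),
      (Model.picardCMUniverse exists_isReal_hodgeModel_holds hodgePQ_independent_of_hodgeModel_holds
        BallQuotient.ballQuotientUniformised_holds cmAbelianVarietyRealised_holds).PeriodNV ι₁ V K R₂.psi σ)
    {P A : AbelianVariety ℂ} (hP : AbelianVariety.IsProductOf (fun B : AbelianVariety ℂ =>
      ∃ (E : Type) (_ : Field E) (_ : NumberField E) (_ : IsCMField E) (_ : E →+* (K : Type)) (Φ : CMType E)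
        (ι : 𝓞 E →+* End B) (θ : E →+* Module.End ℂ (complexBetti B.X 1)),
        IsCMTypeRealisation Φ B ι θ) P)
    (hA : AVDominatedBy A P) : HodgeConjectureFor A.dim A.X :=
  hodgeConjectureFor_of_avDominatedBy_isProductOf_of_exists_facePeriod_on K
    ((show 6 ≤ 8 by decide).trans_eq (FaceCensus.eq_finrank_of_enum e)) {R₁, R₂} σ₀
    (hgen_octicQuaternion K e hmul hconj σ₀ {R₁, R₂} ⟨R₁, by simp, hR₁⟩ ⟨R₂, by simp, hR₂⟩)
    (fun f hf => by
      simp only [Set.mem_insert_iff, Set.mem_singleton_iff] at hf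
      rcases hf with rfl | rfl
      · exact h₁
      · exact h₂) hP hA


/-- **FIELD CLOSURE, type `Q₈` (`QuaternionGroup 2`, `c = a 2`, index `2`) — from AUTOMORPHISM data (the form a field-specific seat
has).** Same conclusion with the dictionary given on `Aut(K)`: a base embedding `σ₀`, a bijection `ε : Aut(K) ≃ Fin 8`
multiplicative for b30's table, the automorphism `c` inducing complex conjugation at `σ₀` with `ε c = 2`, and the faces described
through `ε` (`σ₀ ∘ g ∈ Rᵢ.Φ ↔ ε g ∈` type mask; place representatives `σ₀ ∘ g_p`, `σ₀ ∘ g_q` with the listed place masks). The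
enumeration of `GalT K` is produced by `FaceCensus.exists_enum_of_autEnum` (`CorCM/FaceCensusCells.lean`). (FRAMING: conditional
on the face periods; `HC_CM` is not proved.) [cite: Shimura1998, §6.2 Theorem 3 and §6.1 Corollary of Theorem 2 (pp. 41–43)]
[cite: Pohlmann1968, Thm. 1] [cite: Milne1999LefschetzClasses, Thm. 3.2 and Cor. 4.5] [cite: MumfordAV1970, §19 Thm. 1 and p. 169] -/
theorem hodgeConjectureFor_of_avDominatedBy_isProductOf_of_facePeriod_octicQuaternion_aut (K : CMField) [IsGalois ℚ K]
    (σ₀ : (K : Type) →+* ℂ) (ε : ((K : Type) ≃ₐ[ℚ] (K : Type)) ≃ Fin 8)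
    (hε : ∀ g h : ((K : Type) ≃ₐ[ℚ] (K : Type)), ε (g * h) = Γ.mul (ε g) (ε h))
    (c : ((K : Type) ≃ₐ[ℚ] (K : Type))) (hc : σ₀.comp (c : (K : Type) →+* (K : Type)) = conjugate σ₀) (hεc : ε c = Γ.conj)
    (R₁ R₂ : Face K) (g₁ g₁' : ((K : Type) ≃ₐ[ℚ] (K : Type))) (g₂ g₂' : ((K : Type) ≃ₐ[ℚ] (K : Type)))
    (hΦ₁ : ∀ g : ((K : Type) ≃ₐ[ℚ] (K : Type)),
      σ₀.comp (g : (K : Type) →+* (K : Type)) ∈ R₁.Φ.1 ↔ mem (ε g) 51 = true)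
    (hp₁ : R₁.p = σ₀.comp (g₁ : (K : Type) →+* (K : Type))) (hp₁' : Γ.placeMask (ε g₁) = 5)
    (hq₁ : R₁.p' = σ₀.comp (g₁' : (K : Type) →+* (K : Type))) (hq₁' : Γ.placeMask (ε g₁') = 10)
    (hΦ₂ : ∀ g : ((K : Type) ≃ₐ[ℚ] (K : Type)),
      σ₀.comp (g : (K : Type) →+* (K : Type)) ∈ R₂.Φ.1 ↔ mem (ε g) 51 = true)
    (hp₂ : R₂.p = σ₀.comp (g₂ : (K : Type) →+* (K : Type))) (hp₂' : Γ.placeMask (ε g₂) = 5)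
    (hq₂ : R₂.p' = σ₀.comp (g₂' : (K : Type) →+* (K : Type))) (hq₂' : Γ.placeMask (ε g₂') = 80)
    (h₁ : ∃ ι₁ : K →+* ℂ, R₁.Admissible ι₁ ∧ ∃ (V : HermSpace3 K ι₁) (σ : K →+* ℂ),
      (Model.picardCMUniverse exists_isReal_hodgeModel_holds hodgePQ_independent_of_hodgeModel_holds
        BallQuotient.ballQuotientUniformised_holds cmAbelianVarietyRealised_holds).PeriodNV ι₁ V K R₁.psi σ)
    (h₂ : ∃ ι₁ : K →+* ℂ, R₂.Admissible ι₁ ∧ ∃ (V : HermSpace3 K ι₁) (σ : K →+* ℂ),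
      (Model.picardCMUniverse exists_isReal_hodgeModel_holds hodgePQ_independent_of_hodgeModel_holds
        BallQuotient.ballQuotientUniformised_holds cmAbelianVarietyRealised_holds).PeriodNV ι₁ V K R₂.psi σ)
    {P A : AbelianVariety ℂ} (hP : AbelianVariety.IsProductOf (fun B : AbelianVariety ℂ =>
      ∃ (E : Type) (_ : Field E) (_ : NumberField E) (_ : IsCMField E) (_ : E →+* (K : Type)) (Φ : CMType E)
        (ι : 𝓞 E →+* End B) (θ : E →+* Module.End ℂ (complexBetti B.X 1)),
        IsCMTypeRealisation Φ B ι θ) P)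
    (hA : AVDominatedBy A P) : HodgeConjectureFor A.dim A.X := by
  obtain ⟨e, hmul, he⟩ := FaceCensus.exists_enum_of_autEnum Γ σ₀ ε hε
  have hconj : e conjT = Γ.conj := by rw [FaceCensus.conjT_eq_translate σ₀, ← hc, he, hεc]
  exact hodgeConjectureFor_of_avDominatedBy_isProductOf_of_facePeriod_octicQuaternion K e hmul hconj σ₀ R₁ R₂
    (FaceCensus.reads_of_autEnum Γ e σ₀ ε he R₁ hΦ₁ hp₁ hp₁' hq₁ hq₁')
    (FaceCensus.reads_of_autEnum Γ e σ₀ ε he R₂ hΦ₂ hp₂ hp₂' hq₂ hq₂')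
    h₁ h₂ hP hA

end Summit.HodgeConjecture.CorCM.OcticFaceTransport.Quaternion

namespace Summit.HodgeConjecture.CorCM.OcticFaceTransport.Dihedral

open Summit.HodgeConjecture.CorCM.Census.FaceSquaresModel (mem flipAt)
open Summit.HodgeConjecture.CorCM.Census.OcticFaceSquaresDihedral (Γ genReps certs generation)

/-- **Side check 1 (orbit cells), type `D₄` (`DihedralGroup 4`, `c = r 2`, index `2`):** every generator face of b30's certificates is
one of the eight faces of an explicit orbit cell of a generating representative (four square mates over the twisted places, both
orders). [folklore] -/
theorem orbitCells : (certs.all fun c => c.2.1.all fun gi => genReps.any fun r => (List.finRange 8).any fun j =>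
    [(Γ.twist j r.1, Γ.twist j r.2.1, Γ.twist j r.2.2),
      (flipAt (Γ.twist j r.2.1) (Γ.twist j r.1), Γ.twist j r.2.1, Γ.twist j r.2.2),
      (flipAt (Γ.twist j r.2.2) (Γ.twist j r.1), Γ.twist j r.2.1, Γ.twist j r.2.2),
      (flipAt (Γ.twist j r.2.2) (flipAt (Γ.twist j r.2.1) (Γ.twist j r.1)), Γ.twist j r.2.1, Γ.twist j r.2.2),
      (Γ.twist j r.1, Γ.twist j r.2.2, Γ.twist j r.2.1),
      (flipAt (Γ.twist j r.2.1) (Γ.twist j r.1), Γ.twist j r.2.2, Γ.twist j r.2.1),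
      (flipAt (Γ.twist j r.2.2) (Γ.twist j r.1), Γ.twist j r.2.2, Γ.twist j r.2.1),
      (flipAt (Γ.twist j r.2.2) (flipAt (Γ.twist j r.2.1) (Γ.twist j r.1)), Γ.twist j r.2.2, Γ.twist j r.2.1)].contains gi.1)
    = true := by
  decide +kernel

/-- **Side check 2 (pair labels), type `D₄` (`DihedralGroup 4`, `c = r 2`, index `2`):** every divisor-pair label of b30's
certificates is a CM type of the model. [folklore] -/
theorem pairLabels : (certs.all fun c => c.2.2.all fun pj => Γ.isCMType pj.1) = true := by
  decide +kernel

/-- **The generation binder, type `D₄` (`DihedralGroup 4`, `c = r 2`, index `2`).** `K` a Galois CM field with an enumeration `e :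
GalT K ≃ Fin 8` of its Galois translates, multiplicative for b30's table and with `e conjT = 2`; `σ₀` a base embedding; `𝒮` any
set of faces of `K` containing faces READING AS the 2 generating representative codes `(51, 5, 10)` (type `{0,1,4,5}`, places
`{0,2}`, `{1,3}`), `(51, 5, 80)` (type `{0,1,4,5}`, places `{0,2}`, `{4,6}`) — `σ₀ ∘ P ∈ R.Φ ↔ e P ∈` the type, `R.p`, `R.p′` at
the two places. Then `hgen(𝒮, σ₀)` holds at every face (b30's `generation`: two orbits of the five generate). [cite: Pohlmann1968,
Thm. 1] [cite: Milne1999LefschetzClasses, Thm. 3.2] -/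
theorem hgen_octicDihedral (K : CMField) [IsGalois ℚ K] (e : GalT K ≃ Fin 8)
    (hmul : ∀ P Q : GalT K, e (P * Q) = Γ.mul (e P) (e Q)) (hconj : e conjT = Γ.conj) (σ₀ : (K : Type) →+* ℂ)
    (𝒮 : Set (Face K))
    (h₁ : ∃ R ∈ 𝒮, (∀ P : GalT K, P.1 σ₀ ∈ R.Φ.1 ↔ mem (e P) 51 = true) ∧
      Γ.placeMask (e (translate σ₀ R.p)) = 5 ∧ Γ.placeMask (e (translate σ₀ R.p')) = 10)
    (h₂ : ∃ R ∈ 𝒮, (∀ P : GalT K, P.1 σ₀ ∈ R.Φ.1 ↔ mem (e P) 51 = true) ∧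
      Γ.placeMask (e (translate σ₀ R.p)) = 5 ∧ Γ.placeMask (e (translate σ₀ R.p')) = 80) (f : Face K) :
    lefChar f.corner (fun _ => ({σ₀} : Finset ((K : Type) →+* ℂ))) ∈ AddSubgroup.closure
      {a : Asym K | ∃ g ∈ 𝒮, ∃ σ : (K : Type) →+* ℂ, a = lefChar g.corner (fun _ => ({σ} : Finset ((K : Type) →+* ℂ)))} := by
  refine FaceCensus.hgen_of_generationCertOK Γ e hmul hconj genReps certs generation orbitCells pairLabels σ₀ 𝒮 ?_ f
  intro r hr
  have hr' : r = (51, 5, 10) ∨ r = (51, 5, 80) := by simpa [genReps] using hr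
  rcases hr' with rfl | rfl
  · obtain ⟨R, hRS, hΦ, hp, hq⟩ := h₁
    exact ⟨R, hRS, ⟨by decide, fun i => by rw [mem_pullType, hΦ, e.apply_symm_apply]⟩, hp, hq⟩
  · obtain ⟨R, hRS, hΦ, hp, hq⟩ := h₂
    exact ⟨R, hRS, ⟨by decide, fun i => by rw [mem_pullType, hΦ, e.apply_symm_apply]⟩, hp, hq⟩

/-- **Non-vacuity, type `D₄` (`DihedralGroup 4`, `c = r 2`, index `2`):** under any such enumeration, faces of `K` reading as the
generating representative codes EXIST (`FaceCensus.exists_face_reads`; the codes lie in `Γ.faces` by `decide`). [folklore] -/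
theorem exists_faces_octicDihedral (K : CMField) [IsGalois ℚ K] (e : GalT K ≃ Fin 8)
    (hmul : ∀ P Q : GalT K, e (P * Q) = Γ.mul (e P) (e Q)) (hconj : e conjT = Γ.conj) (σ₀ : (K : Type) →+* ℂ) :
    ∃ R₁ R₂ : Face K,
      ((∀ P : GalT K, P.1 σ₀ ∈ R₁.Φ.1 ↔ mem (e P) 51 = true) ∧
      Γ.placeMask (e (translate σ₀ R₁.p)) = 5 ∧ Γ.placeMask (e (translate σ₀ R₁.p')) = 10) ∧
      ((∀ P : GalT K, P.1 σ₀ ∈ R₂.Φ.1 ↔ mem (e P) 51 = true) ∧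
      Γ.placeMask (e (translate σ₀ R₂.p)) = 5 ∧ Γ.placeMask (e (translate σ₀ R₂.p')) = 80) := by
  obtain ⟨R₁, hT₁, hp₁, hq₁⟩ := FaceCensus.exists_face_reads Γ e hmul hconj σ₀ (r := (51, 5, 10))
    (by decide +kernel)
  obtain ⟨R₂, hT₂, hp₂, hq₂⟩ := FaceCensus.exists_face_reads Γ e hmul hconj σ₀ (r := (51, 5, 80))
    (by decide +kernel)
  exact ⟨R₁, R₂, ⟨fun P => by rw [← mem_pullType, ← e.symm_apply_apply P, ← hT₁.2 (e P), e.symm_apply_apply],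
    hp₁, hq₁⟩, ⟨fun P => by rw [← mem_pullType, ← e.symm_apply_apply P, ← hT₂.2 (e P), e.symm_apply_apply],
    hp₂, hq₂⟩⟩

/-- **FIELD CLOSURE, type `D₄` (`DihedralGroup 4`, `c = r 2`, index `2`) — period-witness form, CLOSED (headline).** `K`, `e`, `σ₀` as
above and 2 faces of `K` reading as the generating representatives; ONE period witness for each on the universe of record (some
admissible `ι₁`, some hermitian 3-space, some level, eigenforms at some `σ`) implies the Hodge conjecture, in every codimension,
for every complex abelian variety dominated by a finite product of abelian varieties realising CM types of CM fields embeddable in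
`K`. (FRAMING: conditional on these 2 face periods; `HC_CM` is not proved.) [cite: Shimura1998, §6.2 Theorem 3 and §6.1 Corollary
of Theorem 2 (pp. 41–43)] [cite: Pohlmann1968, Thm. 1] [cite: Milne1999LefschetzClasses, Thm. 3.2 and Cor. 4.5] [cite:
MumfordAV1970, §19 Thm. 1 and p. 169] -/
theorem hodgeConjectureFor_of_avDominatedBy_isProductOf_of_facePeriod_octicDihedral (K : CMField) [IsGalois ℚ K]
    (e : GalT K ≃ Fin 8) (hmul : ∀ P Q : GalT K, e (P * Q) = Γ.mul (e P) (e Q)) (hconj : e conjT = Γ.conj)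
    (σ₀ : (K : Type) →+* ℂ) (R₁ R₂ : Face K)
    (hR₁ : (∀ P : GalT K, P.1 σ₀ ∈ R₁.Φ.1 ↔ mem (e P) 51 = true) ∧
      Γ.placeMask (e (translate σ₀ R₁.p)) = 5 ∧ Γ.placeMask (e (translate σ₀ R₁.p')) = 10)
    (hR₂ : (∀ P : GalT K, P.1 σ₀ ∈ R₂.Φ.1 ↔ mem (e P) 51 = true) ∧
      Γ.placeMask (e (translate σ₀ R₂.p)) = 5 ∧ Γ.placeMask (e (translate σ₀ R₂.p')) = 80)
    (h₁ : ∃ ι₁ : K →+* ℂ, R₁.Admissible ι₁ ∧ ∃ (V : HermSpace3 K ι₁) (σ : K →+* ℂ),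
      (Model.picardCMUniverse exists_isReal_hodgeModel_holds hodgePQ_independent_of_hodgeModel_holds
        BallQuotient.ballQuotientUniformised_holds cmAbelianVarietyRealised_holds).PeriodNV ι₁ V K R₁.psi σ)
    (h₂ : ∃ ι₁ : K →+* ℂ, R₂.Admissible ι₁ ∧ ∃ (V : HermSpace3 K ι₁) (σ : K →+* ℂ),
      (Model.picardCMUniverse exists_isReal_hodgeModel_holds hodgePQ_independent_of_hodgeModel_holds
        BallQuotient.ballQuotientUniformised_holds cmAbelianVarietyRealised_holds).PeriodNV ι₁ V K R₂.psi σ)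
    {P A : AbelianVariety ℂ} (hP : AbelianVariety.IsProductOf (fun B : AbelianVariety ℂ =>
      ∃ (E : Type) (_ : Field E) (_ : NumberField E) (_ : IsCMField E) (_ : E →+* (K : Type)) (Φ : CMType E)
        (ι : 𝓞 E →+* End B) (θ : E →+* Module.End ℂ (complexBetti B.X 1)),
        IsCMTypeRealisation Φ B ι θ) P)
    (hA : AVDominatedBy A P) : HodgeConjectureFor A.dim A.X :=
  hodgeConjectureFor_of_avDominatedBy_isProductOf_of_exists_facePeriod_on K
    ((show 6 ≤ 8 by decide).trans_eq (FaceCensus.eq_finrank_of_enum e)) {R₁, R₂} σ₀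
    (hgen_octicDihedral K e hmul hconj σ₀ {R₁, R₂} ⟨R₁, by simp, hR₁⟩ ⟨R₂, by simp, hR₂⟩)
    (fun f hf => by
      simp only [Set.mem_insert_iff, Set.mem_singleton_iff] at hf
      rcases hf with rfl | rfl
      · exact h₁
      · exact h₂) hP hA


/-- **FIELD CLOSURE, type `D₄` (`DihedralGroup 4`, `c = r 2`, index `2`) — from AUTOMORPHISM data (the form a field-specific seat
has).** Same conclusion with the dictionary given on `Aut(K)`: a base embedding `σ₀`, a bijection `ε : Aut(K) ≃ Fin 8`
multiplicative for b30's table, the automorphism `c` inducing complex conjugation at `σ₀` with `ε c = 2`, and the faces described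
through `ε` (`σ₀ ∘ g ∈ Rᵢ.Φ ↔ ε g ∈` type mask; place representatives `σ₀ ∘ g_p`, `σ₀ ∘ g_q` with the listed place masks). The
enumeration of `GalT K` is produced by `FaceCensus.exists_enum_of_autEnum` (`CorCM/FaceCensusCells.lean`). (FRAMING: conditional
on the face periods; `HC_CM` is not proved.) [cite: Shimura1998, §6.2 Theorem 3 and §6.1 Corollary of Theorem 2 (pp. 41–43)]
[cite: Pohlmann1968, Thm. 1] [cite: Milne1999LefschetzClasses, Thm. 3.2 and Cor. 4.5] [cite: MumfordAV1970, §19 Thm. 1 and p. 169] -/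
theorem hodgeConjectureFor_of_avDominatedBy_isProductOf_of_facePeriod_octicDihedral_aut (K : CMField) [IsGalois ℚ K]
    (σ₀ : (K : Type) →+* ℂ) (ε : ((K : Type) ≃ₐ[ℚ] (K : Type)) ≃ Fin 8)
    (hε : ∀ g h : ((K : Type) ≃ₐ[ℚ] (K : Type)), ε (g * h) = Γ.mul (ε g) (ε h))
    (c : ((K : Type) ≃ₐ[ℚ] (K : Type))) (hc : σ₀.comp (c : (K : Type) →+* (K : Type)) = conjugate σ₀) (hεc : ε c = Γ.conj)
    (R₁ R₂ : Face K) (g₁ g₁' : ((K : Type) ≃ₐ[ℚ] (K : Type))) (g₂ g₂' : ((K : Type) ≃ₐ[ℚ] (K : Type)))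
    (hΦ₁ : ∀ g : ((K : Type) ≃ₐ[ℚ] (K : Type)),
      σ₀.comp (g : (K : Type) →+* (K : Type)) ∈ R₁.Φ.1 ↔ mem (ε g) 51 = true)
    (hp₁ : R₁.p = σ₀.comp (g₁ : (K : Type) →+* (K : Type))) (hp₁' : Γ.placeMask (ε g₁) = 5)
    (hq₁ : R₁.p' = σ₀.comp (g₁' : (K : Type) →+* (K : Type))) (hq₁' : Γ.placeMask (ε g₁') = 10)
    (hΦ₂ : ∀ g : ((K : Type) ≃ₐ[ℚ] (K : Type)),
      σ₀.comp (g : (K : Type) →+* (K : Type)) ∈ R₂.Φ.1 ↔ mem (ε g) 51 = true)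
    (hp₂ : R₂.p = σ₀.comp (g₂ : (K : Type) →+* (K : Type))) (hp₂' : Γ.placeMask (ε g₂) = 5)
    (hq₂ : R₂.p' = σ₀.comp (g₂' : (K : Type) →+* (K : Type))) (hq₂' : Γ.placeMask (ε g₂') = 80)
    (h₁ : ∃ ι₁ : K →+* ℂ, R₁.Admissible ι₁ ∧ ∃ (V : HermSpace3 K ι₁) (σ : K →+* ℂ),
      (Model.picardCMUniverse exists_isReal_hodgeModel_holds hodgePQ_independent_of_hodgeModel_holds
        BallQuotient.ballQuotientUniformised_holds cmAbelianVarietyRealised_holds).PeriodNV ι₁ V K R₁.psi σ)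
    (h₂ : ∃ ι₁ : K →+* ℂ, R₂.Admissible ι₁ ∧ ∃ (V : HermSpace3 K ι₁) (σ : K →+* ℂ),
      (Model.picardCMUniverse exists_isReal_hodgeModel_holds hodgePQ_independent_of_hodgeModel_holds
        BallQuotient.ballQuotientUniformised_holds cmAbelianVarietyRealised_holds).PeriodNV ι₁ V K R₂.psi σ)
    {P A : AbelianVariety ℂ} (hP : AbelianVariety.IsProductOf (fun B : AbelianVariety ℂ =>
      ∃ (E : Type) (_ : Field E) (_ : NumberField E) (_ : IsCMField E) (_ : E →+* (K : Type)) (Φ : CMType E)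
        (ι : 𝓞 E →+* End B) (θ : E →+* Module.End ℂ (complexBetti B.X 1)),
        IsCMTypeRealisation Φ B ι θ) P)
    (hA : AVDominatedBy A P) : HodgeConjectureFor A.dim A.X := by
  obtain ⟨e, hmul, he⟩ := FaceCensus.exists_enum_of_autEnum Γ σ₀ ε hε
  have hconj : e conjT = Γ.conj := by rw [FaceCensus.conjT_eq_translate σ₀, ← hc, he, hεc]
  exact hodgeConjectureFor_of_avDominatedBy_isProductOf_of_facePeriod_octicDihedral K e hmul hconj σ₀ R₁ R₂
    (FaceCensus.reads_of_autEnum Γ e σ₀ ε he R₁ hΦ₁ hp₁ hp₁' hq₁ hq₁')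
    (FaceCensus.reads_of_autEnum Γ e σ₀ ε he R₂ hΦ₂ hp₂ hp₂' hq₂ hq₂')
    h₁ h₂ hP hA

end Summit.HodgeConjecture.CorCM.OcticFaceTransport.Dihedral


end
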